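import Summits.CriticalPhenomena.PercolationContinuityZ3.Theorems.PercNearOneGluingNoHeavyQuantHeavySingleStep
import Summits.CriticalPhenomena.PercolationContinuityZ3.Theorems.PercNearOneGluingNoHeavyQuantGluedForestSDEC
import HarnessLib

/-!
# QUANT lane R8, T-DEC: THE OPEN-SET SIZE-BIASED DECOMPOSITION OF A GATED FOREST LAW — deep outer gates are free for EVERY forest;
# a forest whose gated mean is at most each sibling's opened mean is SDEC at its TRUE floor, every width, every orientation
# (in particular `k` identical arbitrary trees with `k·q ≤ 1`), GIVEN the `GateStepN` / `SiblingStep` oracle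

builds on p205010 (kernel theorem, internal audit signed; external expert review pending)

Support file (`--supports stmt-CriticalPhenomena-4575`), QUANT lane seat prim-quant-census-1 (gen 26), rung R8 of
`run/shared/lean/prim/quant/LADDER.md`; memo `run/shared/lean/prim/quant/prim-quant-census-1/g26/SIZEBIAS-G26.md`.  Theorems only, standard
axioms, no sorries.  Vocabulary: prim-quant-stmt g39's list binder (`Sib`, `flaw`, `ftop`, `fgates`, `fmean`, `Sib.TreeOK`, `siblingStep_iff_list`),
census-1 g25's canonical root-pattern expansion (`patLaw`, `flaw_pattern`, `subRegate`, `flaw_subRegate`, ✓ `…QuantURPMLaw`), arm-1 g53's tools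
(`fmean_subRegate`, `flaw_facts_weak`, ✓ `…QuantHeavySingleTools`), `decAtT_gate_of_sdec` (arm-1 g46), `decAtT_mixture_finset` (arm-1 g43).

THE IDENTITY (`gate_flaw_eq_sizeBiased_mix`; the structure-level lift of lead g15's atom-level `twoPoint_sizeBiased`, ✓ `…QuantRootReductionSizeBiased`).
For a sibling list `L` (root gates `qᵢ`, opened sub-forest laws `ρᵢ`, means `mᵢ > 0`), an outer gate `a` and a position set `E ≠ ∅` put
`π_E = Π_{i∈E} qᵢ Π_{i∉E} (1 − qᵢ)` (exactly the roots of `E` open), `X_E = ∗_{i∈E} ρᵢ = flaw (subRegate L E 1)` (`flaw_subRegate_one`), `m_E = Σ_{i∈E} mᵢ`: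
  `gate_a (flaw L) = Σ_{E ≠ ∅} λ_E · gate_{b_E} X_E`,   `λ_E = π_E m_E / fmean L`,   `b_E = a · fmean L / m_E`,   `Σ_E λ_E = 1`
— condition on the SET of open roots (`flaw_pattern`) and re-gate each opened sub-forest to the COMMON mean `a · fmean L`; the `δ₀`-masses balance
because `Σ_E π_E m_E = E[open mean] = fmean L` (`sum_pi_mul_fmean_subRegate_one`).  Each component is ONE ORACLE CALL: the opened sub-forest on `E` is
tree-built with `Σ_{i∈E} nᵢ < fgates L` nontrivial gates (`treeBuiltN_flaw_open`) at any floor `v ≤ min x₁ᵢ`.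

* **`decAt_gate_flaw_sizeBiased_of_oracle` (DEEP OUTER GATES ARE FREE, every forest).**  Floor `0 < x < 1`, `L ≠ []` tree-built siblings (`Sib.TreeOK x`),
  the oracle below `fgates L`, an opened-floor bound `0 < v ≤ x₁ᵢ` with the FLOOR CONDITION `x · Σᵢ mᵢ ≤ fmean L · v` (automatic when all `x₁ᵢ = v`,
  `floorCond_of_common_x₁`), an outer gate `0 < a ≤ 1` with `a · fmean L ≤ mᵢ` (all `i`) ⟹ `gate_a (flaw L)` is DEC at floor `a·x` at every layer
  `j < ftop L`.  So the outer gates `a ≤ min mᵢ / fmean L` of the sibling step are free (`a = 1` is `ConvClosedT`); the open content is the middle range.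
* **`sdec_flaw_sizeBiased_of_oracle` (THE MEAN-DOMINATED FAMILY).**  If moreover `fmean L ≤ mᵢ` for every sibling then `SDEC x (ftop L) (flaw L)` — the
  list form of the sibling step on this family at the true floor; NO heavy/light orientation is assumed (contrast arm-1 g53's
  `sdec_flaw_heavySingle_of_oracle`: heavy single + `fmean (L∖s) ≤ q_s mₜ`; the families overlap, neither contains the other).
* **`sdec_flaw_replicate_of_oracle` (IDENTICAL SIBLINGS).**  `k ≥ 1` copies of ANY tree-built sibling `s` with `k · s.q ≤ 1` are SDEC at every floor
  `x ≤ s.q · s.x₁` — the tied / exchangeable configurations (README V411/V415) at small gates, every sub-tree shape, every `k` (for HEAVY-ROOTED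
  glued siblings `(R^A[q](R^B[s]))^k` arm-1 g49's ✓ `…QuantGluedForestSDEC` gives the wider range `k·q·(A + B s) ≤ 4A` with no oracle).
For bare relays the identity is lead g15's `twoPoint_sizeBiased` and the family is typer g17's `rtail_ge_of_mean_le_one` ('sub-unit-mean structures');
here 'mean ≤ 1' becomes 'gated mean ≤ least opened sibling mean'.  CENSUS (exact, `prim-quant-census-1/g26/code/sizebias_check.py`): identity and
`Σ λ = 1` on 400/400 random forests (widths 2–4, depth ≤ 3); family size in arm-1 g53's uniform ensemble 4.6 / 0.6 / 0.02 % of width-3/4/5 groups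
(heavy-balanced 27.7 / 4.4 / 0.5 %), floor condition alone 85–94 %.

HONEST STATUS.  A k-general SUB-FAMILY of the open core and a k-general FREE RANGE of outer gates; `SiblingStep` ⟺ `GateStepN`, `UPartStep`,
`LightResidDECOracle`, `FarTreeRow` remain OPEN; RATE class (log\*) and the honest sentence of `run/shared/lean/prim/quant/README.md` unchanged.
[this work]; nothing here is cited as a published result.  The gluing rows served [cite: KozmaNitzan2024, Conjecture 3 (p. 15)]; product measure
[cite: Grimmett1999, §1.3 p. 10].
-/


noncomputable section

open scoped BigOperators

namespace Summit.CriticalPhenomena.PercolationContinuityZ3.Theorems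
namespace Quant
namespace LawDec

open Finset

/-! ### The fully opened sub-forest on a position set -/

/-- **the fully opened sub-forest on `E` has law `X_E`**: `flaw (subRegate L E 1) = patLaw L E` (in `flaw_subRegate` only the pattern
`A = E` survives, every other term carries a factor `1 − 1`). [this work] -/
theorem flaw_subRegate_one (L : List Sib) (E : Finset (Fin L.length)) (h : ℕ) :
    flaw (subRegate L E (fun _ => (1 : ℝ))) h = patLaw L E h := by
  rw [flaw_subRegate]
  rw [Finset.sum_eq_single_of_mem E (Finset.mem_powerset.2 (Finset.Subset.refl E))]
  · rw [Finset.sdiff_self, Finset.prod_empty, Finset.prod_const_one, one_mul, one_mul]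
  · intro A hA hAE
    have hAs : A ⊆ E := Finset.mem_powerset.1 hA
    obtain ⟨i, hi⟩ : (E \ A).Nonempty := by
      rw [Finset.sdiff_nonempty]
      intro hEA
      exact hAE (Finset.Subset.antisymm hAs hEA)
    rw [Finset.prod_eq_zero hi (by norm_num), mul_zero, zero_mul]

/-- the length of a re-gated sub-forest is `#E`. [this work] -/
theorem length_subRegate (L : List Sib) (E : Finset (Fin L.length)) (o : Fin L.length → ℝ) :
    (subRegate L E o).length = E.card := by
  unfold subRegate
  rw [List.length_map, Finset.length_sort]

/-- **a forest of OPENED trees (all root gates `= 1`) is tree-built with `fgates K − |K|` nontrivial gates** at any floor `0 < v < 1` below every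
sub-forest floor `x₁` (a sure root gate costs no gate: `gate_one`). [this work] -/
theorem treeBuiltN_flaw_open {v : ℝ} (hv0 : 0 < v) (hv1 : v < 1) :
    ∀ K : List Sib, (∀ t ∈ K, t.q = 1 ∧ TreeBuiltN t.x₁ t.n t.M t.ρ ∧ v ≤ t.x₁) →
      ∃ n', n' + K.length ≤ fgates K ∧ TreeBuiltN v n' (ftop K) (flaw K)
  | [], _ => ⟨0, le_rfl, TreeBuiltN.nil v hv0 hv1⟩
  | t :: K, hK => by
    obtain ⟨hq1, hT, hvx⟩ := hK t List.mem_cons_self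
    obtain ⟨n'', hn'', hF⟩ := treeBuiltN_flaw_open hv0 hv1 K (fun u hu => hK u (List.mem_cons_of_mem t hu))
    have hb : TreeBuiltN v t.n t.M (gate t.ρ t.q) := by
      rw [hq1, gate_one]
      exact TreeBuiltN.mono hT hv0 hvx
    refine ⟨n'' + t.n, ?_, TreeBuiltN.conv hF hb⟩
    show n'' + t.n + (K.length + 1) ≤ fgates K + (t.n + 1)
    omega

/-! ### The size-biased weights sum to the gated mean -/

/-- the exact-pattern probabilities sum to `1`: `Σ_{E} Π_{i∈E} qᵢ Π_{i∉E} (1 − qᵢ) = Π_i (qᵢ + (1 − qᵢ)) = 1`. [this work] -/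
theorem sum_pi_eq_one (L : List Sib) :
    ∑ E ∈ (Finset.univ : Finset (Fin L.length)).powerset,
      (∏ i ∈ E, (L.get i).q) * ∏ i ∈ Finset.univ \ E, (1 - (L.get i).q) = 1 := by
  rw [← Finset.prod_add]
  exact Finset.prod_eq_one fun i _ => by ring

/-- **`E[open mean] = fmean`**: `Σ_{E} π_E · fmean (subRegate L E 1) = fmean L` (law-OK siblings), i.e. `Σ_E π_E Σ_{i∈E} mᵢ = Σ_i qᵢ mᵢ` — via
the means of the two sides of `flaw_pattern`. [this work] -/
theorem sum_pi_mul_fmean_subRegate_one (L : List Sib) (hL : ∀ t ∈ L, t.LawOK) :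
    ∑ E ∈ (Finset.univ : Finset (Fin L.length)).powerset,
      ((∏ i ∈ E, (L.get i).q) * ∏ i ∈ Finset.univ \ E, (1 - (L.get i).q)) * fmean (subRegate L E (fun _ => (1 : ℝ))) = fmean L := by
  obtain ⟨_, _, _, fmn⟩ := flaw_facts L hL
  have hget : ∀ i : Fin L.length, (L.get i).LawOK := fun i => hL _ (List.get_mem L i)
  -- the mean of each opened sub-forest, summed over the FULL range `{0..ftop L}`
  have hmE : ∀ E : Finset (Fin L.length),
      ∑ h ∈ Finset.range (ftop L + 1), (h : ℝ) * patLaw L E h = fmean (subRegate L E (fun _ => (1 : ℝ))) := by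
    intro E
    rw [Finset.sum_congr rfl fun h _ => by rw [← flaw_subRegate_one L E h]]
    have hK : ∀ t ∈ subRegate L E (fun _ => (1 : ℝ)), 0 ≤ t.q ∧ t.q ≤ 1 ∧ (∀ h, 0 ≤ t.ρ h) ∧ (∀ h, t.M < h → t.ρ h = 0) ∧
        ∑ h ∈ Finset.range (t.M + 1), t.ρ h = 1 := by
      intro t ht
      obtain ⟨i, _, rfl⟩ := (mem_subRegate L E _ t).1 ht
      obtain ⟨_, _, ρ0, ρM, ρ1⟩ := hget i
      exact ⟨zero_le_one, le_rfl, ρ0, ρM, ρ1⟩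
    obtain ⟨_, _, _, cmn⟩ := flaw_facts_weak (subRegate L E (fun _ => (1 : ℝ))) hK
    have hsub : Finset.range (ftop (subRegate L E (fun _ => (1 : ℝ))) + 1) ⊆ Finset.range (ftop L + 1) := by
      have hle := ftop_subRegate_le L E (fun _ => (1 : ℝ))
      exact Finset.range_subset_range.2 (by omega)
    rw [← cmn]
    symm
    refine Finset.sum_subset hsub ?_
    intro h _ hnot
    have hlt : ftop (subRegate L E (fun _ => (1 : ℝ))) < h := by
      rw [Finset.mem_range] at hnot; omega
    rw [flaw_eq_zero_of_lt _ h hlt, mul_zero]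
  have e1 : ∀ h : ℕ, (h : ℝ) * flaw L h = ∑ E ∈ (Finset.univ : Finset (Fin L.length)).powerset,
      ((∏ i ∈ E, (L.get i).q) * ∏ i ∈ Finset.univ \ E, (1 - (L.get i).q)) * ((h : ℝ) * patLaw L E h) := by
    intro h
    rw [flaw_pattern, Finset.mul_sum]
    exact Finset.sum_congr rfl fun E _ => by ring
  rw [← fmn, Finset.sum_congr rfl fun h _ => e1 h, Finset.sum_comm]
  refine Finset.sum_congr rfl fun E _ => ?_
  rw [← Finset.mul_sum, hmE E]

/-- gated mean of the fully opened sub-forest: `fmean (subRegate L E 1) = Σ_{i∈E} mᵢ`. [this work] -/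
theorem fmean_subRegate_one (L : List Sib) (E : Finset (Fin L.length)) :
    fmean (subRegate L E (fun _ => (1 : ℝ))) = ∑ i ∈ E, (L.get i).mean := by
  rw [fmean_subRegate]; exact Finset.sum_congr rfl fun i _ => one_mul _

/-- positivity of `fmean` for law-OK siblings with positive opened means. [this work] -/
theorem fmean_pos_of_ne_nil (L : List Sib) (hL : ∀ t ∈ L, t.LawOK) (hmpos : ∀ i : Fin L.length, 0 < (L.get i).mean)
    (hne : L ≠ []) : 0 < fmean L := by
  rw [fmean_eq_sum_get]
  exact Finset.sum_pos (fun i _ => mul_pos (hL _ (List.get_mem L i)).1 (hmpos i))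
    (Finset.univ_nonempty_iff.2 ⟨⟨0, List.length_pos_of_ne_nil hne⟩⟩)

/-- **the size-biased weights sum to one**: `Σ_{E ≠ ∅} π_E · m_E / fmean L = 1`. [this work] -/
theorem sum_sizeBiased_weights (L : List Sib) (hL : ∀ t ∈ L, t.LawOK) (hmpos : ∀ i : Fin L.length, 0 < (L.get i).mean)
    (hne : L ≠ []) :
    ∑ E ∈ (Finset.univ : Finset (Fin L.length)).powerset.erase ∅,
      ((∏ i ∈ E, (L.get i).q) * ∏ i ∈ Finset.univ \ E, (1 - (L.get i).q)) * fmean (subRegate L E (fun _ => (1 : ℝ))) / fmean L = 1 := by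
  rw [← Finset.sum_div, Finset.sum_erase _ (by rw [fmean_subRegate_one, Finset.sum_empty, mul_zero]),
    sum_pi_mul_fmean_subRegate_one L hL, div_self (fmean_pos_of_ne_nil L hL hmpos hne).ne']

/-! ### The identity at law level -/

/-- **THE OPEN-SET SIZE-BIASED DECOMPOSITION (law level, every width, every outer gate `a`).**  For law-OK siblings with positive opened
means and `L ≠ []`: `gate_a (flaw L) h = Σ_{E ≠ ∅} λ_E · gate_{b_E} (flaw (subRegate L E 1)) h` with `λ_E = π_E · m_E / fmean L`,
`b_E = a · fmean L / m_E` (`π_E` the exact-pattern probability, `m_E = fmean (subRegate L E 1) = Σ_{i∈E} mᵢ`).  Every component has gated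
mean EXACTLY `a · fmean L`. [this work] -/
theorem gate_flaw_eq_sizeBiased_mix (L : List Sib) (hL : ∀ t ∈ L, t.LawOK) (hmpos : ∀ i : Fin L.length, 0 < (L.get i).mean)
    (hne : L ≠ []) (a : ℝ) (h : ℕ) :
    gate (flaw L) a h = ∑ E ∈ (Finset.univ : Finset (Fin L.length)).powerset.erase ∅,
      (((∏ i ∈ E, (L.get i).q) * ∏ i ∈ Finset.univ \ E, (1 - (L.get i).q)) * fmean (subRegate L E (fun _ => (1 : ℝ))) / fmean L) *
        gate (flaw (subRegate L E (fun _ => (1 : ℝ)))) (a * fmean L / fmean (subRegate L E (fun _ => (1 : ℝ)))) h := by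
  classical
  have hfm : 0 < fmean L := fmean_pos_of_ne_nil L hL hmpos hne
  have hw1 := sum_sizeBiased_weights L hL hmpos hne
  set Pw : Finset (Finset (Fin L.length)) := (Finset.univ : Finset (Fin L.length)).powerset with hPw
  set Pp : Finset (Finset (Fin L.length)) := Pw.erase ∅ with hPp
  set piE : Finset (Fin L.length) → ℝ := fun E => (∏ i ∈ E, (L.get i).q) * ∏ i ∈ Finset.univ \ E, (1 - (L.get i).q)
    with hpiEdef
  set cmp : Finset (Fin L.length) → List Sib := fun E => subRegate L E (fun _ => (1 : ℝ)) with hcmpdef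
  set lam : Finset (Fin L.length) → ℝ := fun E => piE E * fmean (cmp E) / fmean L with hlamdef
  set b : Finset (Fin L.length) → ℝ := fun E => a * fmean L / fmean (cmp E) with hbdef
  show gate (flaw L) a h = ∑ E ∈ Pp, lam E * gate (flaw (cmp E)) (b E) h
  replace hw1 : ∑ E ∈ Pp, lam E = 1 := hw1
  have hpiPp : ∑ E ∈ Pp, piE E = 1 - piE ∅ := by
    rw [← sum_pi_eq_one L, ← Finset.add_sum_erase Pw piE (Finset.empty_mem_powerset _)]
    ring
  have hmEpos : ∀ E ∈ Pp, 0 < fmean (cmp E) := by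
    intro E hE
    show 0 < fmean (subRegate L E (fun _ => (1 : ℝ)))
    rw [fmean_subRegate_one]
    exact Finset.sum_pos (fun i _ => hmpos i) (Finset.nonempty_iff_ne_empty.2 (Finset.ne_of_mem_erase hE))
  have hlb : ∀ E ∈ Pp, lam E * b E = a * piE E := by
    intro E hE
    have h1 := (hmEpos E hE).ne'
    have h2 := hfm.ne'
    show piE E * fmean (cmp E) / fmean L * (a * fmean L / fmean (cmp E)) = a * piE E
    field_simp
  have hterm : ∀ E ∈ Pp, lam E * gate (flaw (cmp E)) (b E) h
      = a * (piE E * patLaw L E h) + (if h = 0 then (1 : ℝ) else 0) * (lam E - a * piE E) := by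
    intro E hE
    rw [gate_apply, hcmpdef]
    simp only
    rw [flaw_subRegate_one]
    have := hlb E hE
    calc lam E * (b E * patLaw L E h + (1 - b E) * (if h = 0 then (1 : ℝ) else 0))
        = (lam E * b E) * patLaw L E h + (if h = 0 then (1 : ℝ) else 0) * (lam E - lam E * b E) := by ring
      _ = a * (piE E * patLaw L E h) + (if h = 0 then (1 : ℝ) else 0) * (lam E - a * piE E) := by rw [this]; ring
  rw [Finset.sum_congr rfl hterm, Finset.sum_add_distrib, ← Finset.mul_sum, ← Finset.mul_sum, Finset.sum_sub_distrib, hw1,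
    ← Finset.mul_sum, hpiPp]
  have A2 : flaw L h = ∑ E ∈ Pw, piE E * patLaw L E h := flaw_pattern L h
  have A3 : ∑ E ∈ Pw, piE E * patLaw L E h = piE ∅ * patLaw L ∅ h + ∑ E ∈ Pp, piE E * patLaw L E h :=
    (Finset.add_sum_erase Pw _ (Finset.empty_mem_powerset _)).symm
  rw [gate_apply, A2, A3, patLaw_empty]
  split_ifs <;> ring

/-! ### The mean-dominated sibling step -/

/-- **DEEP OUTER GATES ARE FREE (the open-set size-biased decomposition, DEC form).**  See the module docstring: for a non-empty list of tree-built
siblings at floor `x`, the oracle below `fgates L`, a common opened-floor bound `0 < v ≤ x₁ᵢ` with `x · Σᵢ mean ρᵢ ≤ fmean L · v`, and an outer gate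
`0 < a ≤ 1` with `a · fmean L ≤ mean ρᵢ` for every sibling, the gated forest `gate (flaw L) a` is DEC at floor `a·x` at every layer `j < ftop L`.
[this work] -/
theorem decAt_gate_flaw_sizeBiased_of_oracle {x v a : ℝ} (hx0 : 0 < x) (hx1 : x < 1) (L : List Sib)
    (hL : ∀ t ∈ L, t.TreeOK x) (hne : L ≠ [])
    (hO : ∀ (x' : ℝ) (n' M' : ℕ) (μ' : ℕ → ℝ), n' < fgates L → TreeBuiltN x' n' M' μ' → SDEC x' M' μ')
    (hv0 : 0 < v) (hv : ∀ t ∈ L, v ≤ t.x₁)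
    (hfl : x * ∑ i : Fin L.length, (L.get i).mean ≤ fmean L * v)
    (ha0 : 0 < a) (ha1 : a ≤ 1) (ham : ∀ t ∈ L, a * fmean L ≤ t.mean) :
    ∀ j, j < ftop L → DECAt (a * x) j (ftop L) (gate (flaw L) a) := by
  classical
  intro j _
  have hL' : ∀ t ∈ L, t.LawOK := fun t ht => (hL t ht).lawOK
  have hget : ∀ i : Fin L.length, (L.get i).TreeOK x := fun i => hL _ (List.get_mem L i)
  have hqpos : ∀ i : Fin L.length, 0 < (L.get i).q := fun i => (hget i).1
  have hqlt : ∀ i : Fin L.length, (L.get i).q < 1 := fun i => (hget i).2.1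
  have hmpos : ∀ i : Fin L.length, 0 < (L.get i).mean := fun i => (L.get i).mean_pos (hget i)
  have hk : 0 < L.length := List.length_pos_of_ne_nil hne
  have hfm : 0 < fmean L := fmean_pos_of_ne_nil L hL' hmpos hne
  -- `v < 1` (some sibling has `x₁ < 1`)
  have hv1 : v < 1 := by
    obtain ⟨_, _, _, iT, _⟩ := hget ⟨0, hk⟩
    obtain ⟨_, ix₁1, _, _, _, _⟩ := iT.lawFacts
    exact lt_of_le_of_lt (hv _ (List.get_mem L _)) ix₁1
  set z : ℝ := a * x with hzdef
  have hz1 : z < 1 := by rw [hzdef]; nlinarith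
  set TE : ℝ := a * fmean L with hTEdef
  set Pw : Finset (Finset (Fin L.length)) := (Finset.univ : Finset (Fin L.length)).powerset with hPw
  set Pp : Finset (Finset (Fin L.length)) := Pw.erase ∅ with hPp
  set piE : Finset (Fin L.length) → ℝ := fun E => (∏ i ∈ E, (L.get i).q) * ∏ i ∈ Finset.univ \ E, (1 - (L.get i).q)
    with hpiEdef
  set cmp : Finset (Fin L.length) → List Sib := fun E => subRegate L E (fun _ => (1 : ℝ)) with hcmpdef
  set lam : Finset (Fin L.length) → ℝ := fun E => piE E * fmean (cmp E) / fmean L with hlamdef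
  set b : Finset (Fin L.length) → ℝ := fun E => a * fmean L / fmean (cmp E) with hbdef
  have hpi0 : ∀ E, 0 ≤ piE E := by
    intro E
    exact mul_nonneg (Finset.prod_nonneg fun i _ => (hqpos i).le) (Finset.prod_nonneg fun i _ => by linarith [hqlt i])
  have hmeanE : ∀ E, fmean (cmp E) = ∑ i ∈ E, (L.get i).mean := fun E => fmean_subRegate_one L E
  have hmEpos : ∀ E ∈ Pp, 0 < fmean (cmp E) := by
    intro E hE
    have hEne : E.Nonempty := Finset.nonempty_iff_ne_empty.2 (Finset.ne_of_mem_erase hE)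
    rw [hmeanE]; exact Finset.sum_pos (fun i _ => hmpos i) hEne
  have hmEle : ∀ E, fmean (cmp E) ≤ ∑ i : Fin L.length, (L.get i).mean := by
    intro E
    rw [hmeanE]; exact Finset.sum_le_univ_sum_of_nonneg fun i => (hmpos i).le
  have hmEge : ∀ E ∈ Pp, a * fmean L ≤ fmean (cmp E) := by
    intro E hE
    obtain ⟨i₀, hi₀⟩ : E.Nonempty := Finset.nonempty_iff_ne_empty.2 (Finset.ne_of_mem_erase hE)
    rw [hmeanE]
    calc a * fmean L ≤ (L.get i₀).mean := ham _ (List.get_mem L i₀)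
      _ ≤ ∑ i ∈ E, (L.get i).mean := Finset.single_le_sum (fun i _ => (hmpos i).le) hi₀
  have hw0 : ∀ E ∈ Pp, 0 ≤ lam E := fun E hE => div_nonneg (mul_nonneg (hpi0 E) (hmEpos E hE).le) hfm.le
  have hw1 : ∑ E ∈ Pp, lam E = 1 := sum_sizeBiased_weights L hL' hmpos hne
  have hb0 : ∀ E ∈ Pp, 0 < b E := fun E hE => div_pos (mul_pos ha0 hfm) (hmEpos E hE)
  have hb1 : ∀ E ∈ Pp, b E ≤ 1 := fun E hE => by
    show a * fmean L / fmean (cmp E) ≤ 1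
    rw [div_le_one (hmEpos E hE)]; exact hmEge E hE
  -- THE IDENTITY (`gate_flaw_eq_sizeBiased_mix`): `gate_a (flaw L) = Σ_{E ≠ ∅} lam_E · gate_{b_E} (flaw (cmp E))`
  have e : gate (flaw L) a = fun h => ∑ E ∈ Pp, lam E * gate (flaw (cmp E)) (b E) h :=
    funext fun h => gate_flaw_eq_sizeBiased_mix L hL' hmpos hne a h
  -- EACH COMPONENT IS ONE ORACLE CALL at floor `v`, DEC at floor `z` with target EXACTLY `TE`
  have hUE : ∀ E ∈ Pp, 0 < lam E → DECAtT z TE j (ftop L) (gate (flaw (cmp E)) (b E)) := by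
    intro E hE _
    have hEne : E.Nonempty := Finset.nonempty_iff_ne_empty.2 (Finset.ne_of_mem_erase hE)
    have hK : ∀ t ∈ cmp E, t.q = 1 ∧ TreeBuiltN t.x₁ t.n t.M t.ρ ∧ v ≤ t.x₁ := by
      intro t ht
      obtain ⟨i, _, rfl⟩ := (mem_subRegate L E _ t).1 ht
      obtain ⟨_, _, _, iT, _⟩ := hget i
      exact ⟨rfl, iT, hv (L.get i) (List.get_mem L i)⟩
    have hKlaw : ∀ t ∈ cmp E, 0 ≤ t.q ∧ t.q ≤ 1 ∧ (∀ h, 0 ≤ t.ρ h) ∧ (∀ h, t.M < h → t.ρ h = 0) ∧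
        ∑ h ∈ Finset.range (t.M + 1), t.ρ h = 1 := by
      intro t ht
      obtain ⟨tq1, tT, _⟩ := hK t ht
      obtain ⟨_, _, t0, tM, t1, _⟩ := tT.lawFacts
      exact ⟨by rw [tq1]; exact zero_le_one, le_of_eq tq1, t0, tM, t1⟩
    obtain ⟨nE, hnE, hTE⟩ := treeBuiltN_flaw_open hv0 hv1 (cmp E) hK
    obtain ⟨c0, cM, c1, cmn⟩ := flaw_facts_weak (cmp E) hKlaw
    obtain ⟨_, _, _, _, _, Fta⟩ := hTE.lawFacts
    -- the oracle call: fewer than `fgates L` nontrivial gates (`|E| ≥ 1` sure root gates are not counted)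
    have hlen : (cmp E).length = E.card := length_subRegate L E _
    have hcard : 0 < E.card := Finset.card_pos.2 hEne
    have hgates : fgates (cmp E) ≤ fgates L := fgates_subRegate_le L E _
    have hSE : SDEC v (ftop (cmp E)) (flaw (cmp E)) := hO v nE _ _ (by omega) hTE
    -- DEC of the gated component at floor `z ≤ b_E · v`, target `b_E · fmean (cmp E) = TE`
    have hzb : z ≤ b E * v := by
      show a * x ≤ a * fmean L / fmean (cmp E) * v
      rw [div_mul_eq_mul_div, le_div_iff₀ (hmEpos E hE)]
      have h1 : x * fmean (cmp E) ≤ fmean L * v :=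
        (mul_le_mul_of_nonneg_left (hmEle E) hx0.le).trans hfl
      nlinarith
    have d := decAtT_gate_of_sdec (ftop (cmp E)) (flaw (cmp E)) v (b E) z hv0.le (hb0 E hE) (hb1 E hE)
      (mul_lt_one_aux (hb1 E hE) hv0.le hv1) hzb c0 cM c1 Fta hSE j
    rw [cmn] at d
    have eT : b E * fmean (cmp E) = TE := by
      show a * fmean L / fmean (cmp E) * fmean (cmp E) = a * fmean L
      exact div_mul_cancel₀ _ (hmEpos E hE).ne'
    rw [eT] at d
    exact decAtT_mono_top d (ftop_subRegate_le L E _)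
  have hmix : DECAtT z TE j (ftop L) (fun h => ∑ E ∈ Pp, lam E * gate (flaw (cmp E)) (b E) h) :=
    decAtT_mixture_finset Pp lam _ hw0 hw1 hUE
  -- the mean of the gated forest is `TE`
  obtain ⟨_, _, _, tmn⟩ := flaw_facts L hL'
  have hEmean : ∑ h ∈ Finset.range (ftop L + 1), (h : ℝ) * gate (flaw L) a h = TE := by
    rw [sum_mul_gate, tmn]
  rw [decAt_iff_decAtT, hEmean, e]
  exact hmix

/-- **THE MEAN-DOMINATED SIBLING STEP, EVERY WIDTH, EVERY ORIENTATION (SDEC form).**  For a floor `0 < x < 1`, a non-empty list `L` of tree-built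
siblings (`Sib.TreeOK x`), GIVEN the oracle "every tree-built law with fewer than `fgates L` nontrivial gates is SDEC" (the induction hypothesis of
`SiblingStep` / `GateStepN`), a common opened-floor bound `0 < v ≤ x₁ᵢ` with the floor condition `x · Σᵢ mean ρᵢ ≤ fmean L · v`, and the MEAN
DOMINATION `fmean L ≤ mean ρᵢ` for every sibling: `SDEC x (ftop L) (flaw L)` — the list form of the sibling step (`siblingStep_iff_list`) on this
family, at the forest's true floor. [this work] -/
theorem sdec_flaw_sizeBiased_of_oracle {x v : ℝ} (hx0 : 0 < x) (hx1 : x < 1) (L : List Sib)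
    (hL : ∀ t ∈ L, t.TreeOK x) (hne : L ≠ [])
    (hO : ∀ (x' : ℝ) (n' M' : ℕ) (μ' : ℕ → ℝ), n' < fgates L → TreeBuiltN x' n' M' μ' → SDEC x' M' μ')
    (hv0 : 0 < v) (hv : ∀ t ∈ L, v ≤ t.x₁)
    (hfl : x * ∑ i : Fin L.length, (L.get i).mean ≤ fmean L * v)
    (hm : ∀ t ∈ L, fmean L ≤ t.mean) :
    SDEC x (ftop L) (flaw L) := by
  intro a ha0 ha1 j hj
  refine decAt_gate_flaw_sizeBiased_of_oracle hx0 hx1 L hL hne hO hv0 hv hfl ha0 ha1 (fun t ht => ?_) j hj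
  have h0 : 0 ≤ fmean L := by
    rw [fmean_eq_sum_get]
    exact Finset.sum_nonneg fun i _ =>
      mul_nonneg (hL _ (List.get_mem L i)).1.le ((L.get i).mean_pos (hL _ (List.get_mem L i))).le
  calc a * fmean L ≤ 1 * fmean L := mul_le_mul_of_nonneg_right ha1 h0
    _ = fmean L := one_mul _
    _ ≤ t.mean := hm t ht

/-! ### Common opened floor; identical siblings -/

/-- **the floor condition is automatic for a common opened floor**: if every sibling has `x₁ᵢ = v` (and `x ≤ qᵢ·x₁ᵢ`, `mean ρᵢ ≥ 0`, as for
tree-built siblings at floor `x`) then `x · Σᵢ mean ρᵢ ≤ fmean L · v`. [this work] -/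
theorem floorCond_of_common_x₁ {x v : ℝ} (L : List Sib) (hL : ∀ t ∈ L, t.TreeOK x) (hv : ∀ t ∈ L, t.x₁ = v) :
    x * ∑ i : Fin L.length, (L.get i).mean ≤ fmean L * v := by
  rw [fmean_eq_sum_get, Finset.mul_sum, Finset.sum_mul]
  refine Finset.sum_le_sum fun i _ => ?_
  have hi := hL _ (List.get_mem L i)
  have hm0 : 0 ≤ (L.get i).mean := ((L.get i).mean_pos hi).le
  have hxq : x ≤ (L.get i).q * v := by rw [← hv _ (List.get_mem L i)]; exact hi.2.2.1
  calc x * (L.get i).mean ≤ (L.get i).q * v * (L.get i).mean := mul_le_mul_of_nonneg_right hxq hm0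
    _ = (L.get i).q * (L.get i).mean * v := by ring

/-- **IDENTICAL SIBLINGS WITH `k · q ≤ 1` (every sub-tree shape, every `k ≥ 1`).**  For a tree-built sibling `s` at floor `x` (`Sib.TreeOK x`:
`0 < s.q < 1`, `x ≤ s.q · s.x₁`, `s.ρ` tree-built and not a point mass) and `k ≥ 1` with `k · s.q ≤ 1`, GIVEN the oracle below
`fgates (replicate k s)`: the forest of `k` copies of `s` is SDEC at `x` — the sibling step on the tied / exchangeable family at small gates.
[this work] -/
theorem sdec_flaw_replicate_of_oracle {x : ℝ} (hx0 : 0 < x) (hx1 : x < 1) (s : Sib) (hs : s.TreeOK x) (k : ℕ) (hk : 1 ≤ k)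
    (hkq : (k : ℝ) * s.q ≤ 1)
    (hO : ∀ (x' : ℝ) (n' M' : ℕ) (μ' : ℕ → ℝ), n' < fgates (List.replicate k s) → TreeBuiltN x' n' M' μ' → SDEC x' M' μ') :
    SDEC x (ftop (List.replicate k s)) (flaw (List.replicate k s)) := by
  have hmem : ∀ t ∈ List.replicate k s, t = s := fun t ht => List.eq_of_mem_replicate ht
  have hL : ∀ t ∈ List.replicate k s, t.TreeOK x := fun t ht => by rw [hmem t ht]; exact hs
  have hne : List.replicate k s ≠ [] := by
    intro h
    have := congrArg List.length h
    simp only [List.length_replicate, List.length_nil] at this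
    omega
  obtain ⟨hq0, _, hxq, hT, _⟩ := hs
  obtain ⟨hx₁0, _, _, _, _, _⟩ := hT.lawFacts
  have hmpos : 0 < s.mean := s.mean_pos (hL s (by rw [List.mem_replicate]; exact ⟨by omega, rfl⟩))
  refine sdec_flaw_sizeBiased_of_oracle hx0 hx1 _ hL hne hO hx₁0 (fun t ht => by rw [hmem t ht])
    (floorCond_of_common_x₁ _ hL fun t ht => by rw [hmem t ht]) fun t ht => ?_
  rw [hmem t ht, fmean_replicate k s]
  calc (k : ℝ) * (s.q * s.mean) = ((k : ℝ) * s.q) * s.mean := by ring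
    _ ≤ 1 * s.mean := mul_le_mul_of_nonneg_right hkq hmpos.le
    _ = s.mean := one_mul _

end LawDec
end Quant
end Summit.CriticalPhenomena.PercolationContinuityZ3.Theorems
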